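import Literature.Topology.LocallyConstantOrbitCells          -- ★∕HOME FILE 1 (LH4-p02 (g2)): uniform invariance, cells, cell decomposition, normal refinement
import Literature.Topology.Algebra.CompactOpenSubgroupTrace     -- ★ `exists_isOpen_subgroup_le_subset_conj_mem` (open subgroups ≤ K₀ normalised by K₀ form a basis of `𝓝 1`)
import Literature.MeasureTheory.Group.InvariantQuotientDoubleCosetUnfolding   -- ★ `mem_comap_conj_iff`, `isOpen_coe_comap_conj`, `isCompact_coe_comap_conj` (the conjugate subgroup `g⁻¹ K g = K.comap (conj g)`)
import Literature.GroupTheory.SaturatedConjClassDecomposition   -- ★ `Literature.GroupTheory.isLocallyConstant_indicator_const_of_isClopen`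
import Mathlib.MeasureTheory.Group.Action
import Mathlib.MeasureTheory.Integral.Bochner.Basic
import Mathlib.MeasureTheory.Integral.Bochner.Set
import Mathlib.MeasureTheory.Measure.OpenPos
import Mathlib.Topology.Algebra.Group.OpenMapping
import Mathlib.LinearAlgebra.Basis.VectorSpace
import HarnessLib
/-!
# Uniqueness of invariant linear functionals on the locally constant compactly supported functions of ONE orbit
# («Haar uniqueness on `S(X)`», Bernstein–Zelevinsky 1976 §1)

Topic `MeasureTheory/Group`; namespace `Literature.MeasureTheory.Group`.  THEOREMS ONLY (no definition, no instance, no notation, no named fact,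
no `sorry`).  Cell `pub/hodgecm-mathlib` (D-0151), crux H413 = `stmt-HodgeConjecture-24833`, line LH4 (closer stub `stub_N6ns`; PRINT residual
`stub_N6nsShalika` = ★ def `ShalikaGermExpansionNonsplit L Φ₃ v`, [Rogawski1990, Prop. 8.1.1 p. 112]); Shalika sub-road LAYER 2, organ «COINV-1», FILE 2 of 2
(FILE 1 = ★∕HOME `Literature/Topology/LocallyConstantOrbitCells.lean`: uniform invariance, cells, cell decomposition, normal refinement).

THE STATEMENT.  `G` a totally disconnected topological group with a compact open subgroup `K₀`, acting continuously and TRANSITIVELY on a topological space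
`X` with OPEN orbit maps `g ↦ g • x` (a quotient `G ⧸ H`; one orbit of a σ-compact `G` in a Baire space — Mathlib `isOpenMap_smul_of_sigmaCompact`);
`μ` a `G`-invariant measure on `X`, finite on compact sets and positive on non-empty open sets.  THEN every `G`-INVARIANT `ℂ`-LINEAR FUNCTIONAL `T` on
`S(X)` (the locally constant compactly supported `F : X → ℂ`; `T` is given on all of `X → ℂ`, only its values on `S(X)` matter) is a scalar multiple
of `μ`: `∃ c, ∀ F ∈ S(X), T F = c · ∫ F dμ` (`exists_forall_apply_eq_const_mul_integral_of_smul_invariant`).  This is the «dimension ≤ 1» of the space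
of invariant distributions on ONE orbit — the per-stratum step of the Howe ∕ Harish-Chandra induction proving that the invariant distributions supported on
the unipotent variety are spanned by the unipotent orbital integrals ([Rogawski1990, p. 113]; [Howe1974, Prop. 2]; [BernsteinZelevinsky1976, §1]) —
for BARE linear forms: no positivity, no continuity (the ★ measure-uniqueness layer `InvariantQuotientUniqueness` ∕ `InvariantOrbitMeasureUniqueness`
is the Radon-measure statement and does not apply to them).

THE PROOF (cells; no Haar theory).  (§2) For a compact open subgroup `M` and an open `N ≤ M` normalised by `M`, the compact open cell `M • x` is the
disjoint union of `k ≥ 1` cells `m • (N • x)` (★ FILE 1 «NORMAL REFINEMENT»); `T` and `μ` take the same value on each (invariance), so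
`T(1_{M•x}) = k · T(1_{N•x})` and `μ(M•x) = k · μ(N•x)`.  (§3) For ANY two compact open subgroups `M₁, M₂`: three refinements `M₁ ⊵ N₁ ⊵ N₂ ⊴ M₂`
(★ `exists_isOpen_subgroup_le_subset_conj_mem`) give `T(1_{M₁•x}) · μ(M₂•x) = T(1_{M₂•x}) · μ(M₁•x)`.  (§4) Transport `M • (g • x₀) = g • (M^g • x₀)`,
`M^g = g⁻¹ M g`, moves every cell to the base point, so `T(1_{N•y}) = c · μ(N•y)` with `c = T(1_{K₀•x₀}) ∕ μ(K₀•x₀)` for every compact open `N` and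
every `y`.  (§5) Every `F ∈ S(X)` is invariant under a small compact open `N` (★ FILE 1 §1) and is a finite combination of cells `N • y` (★ FILE 1 §3).
(§1) Rider: an invariant measure `μ ≠ 0` is positive on opens when `G` is σ-compact (the tree's `IsAdmissibleOn` triple feeds the theorem).

HONEST LABEL: pure measure theory ∕ topology, count-neutral, pays no letter; HC_CM is proved only modulo the 7 printed citations (2 remaining: hLiu418 =
stmt-HodgeConjecture-24832, h413 = stmt-HodgeConjecture-24833) until rung 0 closes.

## References
* [BernsteinZelevinsky1976] I. N. Bernstein, A. V. Zelevinsky, *Representations of the group GL(n, F) where F is a non-archimedean local field*, Russian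
  Math. Surveys 31:3 (1976): §1 (`ℓ`-spaces and `ℓ`-groups, `S(X)`, invariant distributions on homogeneous spaces, Prop. 1.18 ff.).
* [Rogawski1990] J. D. Rogawski, *Automorphic Representations of Unitary Groups in Three Variables*, Ann. of Math. Stud. 123 (1990): §8.1, proof of Prop.
  8.1.1 p. 113 (Howe's argument).
* [Howe1974] R. Howe, *The Fourier transform and germs of characters (case of Gl_n over a p-adic field)*, Math. Ann. 208 (1974) 305–322: Prop. 2.
-/

set_option autoImplicit false

noncomputable section

open Set Filter Topology MulAction MeasureTheory MeasureTheory.Measure Literature.Topology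
open scoped Pointwise

namespace Literature.MeasureTheory.Group

/-! ## §1 Rider: a non-zero invariant measure on one orbit of a σ-compact group is positive on open sets -/

section OpenPos

variable {G : Type*} [Group G] [TopologicalSpace G] {X : Type*} [TopologicalSpace X] [MulAction G X] [MeasurableSpace X]

/-- **A non-zero `G`-invariant measure on a homogeneous `G`-space is positive on non-empty open sets** when `G` is σ-compact and the orbit maps are
continuous (every compact set is covered by finitely many translates of the open set). [cite: BernsteinZelevinsky1976, §1.18] -/
theorem isOpenPosMeasure_of_smulInvariantMeasure_ne_zero [SigmaCompactSpace G] [ContinuousConstSMul G X] [IsPretransitive G X]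
    (hcont : ∀ x : X, Continuous fun g : G => g • x) (μ : Measure X) [SMulInvariantMeasure G X μ] (hμ : μ ≠ 0) :
    μ.IsOpenPosMeasure := by
  refine ⟨fun U hU hne => fun hU0 => hμ ?_⟩
  obtain ⟨x, hx⟩ := hne
  -- `X` is σ-compact: the image of `G` under the orbit map of `x`
  have hcov : ∀ K : Set X, IsCompact K → μ K = 0 := by
    intro K hK
    have hKU : K ⊆ ⋃ g : G, g • U := fun y _ => by
      obtain ⟨g, rfl⟩ := exists_smul_eq G x y
      exact mem_iUnion.2 ⟨g, smul_mem_smul_set hx⟩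
    obtain ⟨t, ht⟩ := hK.elim_finite_subcover (fun g : G => g • U) (fun g => hU.smul g) hKU
    exact measure_mono_null ht ((measure_biUnion_null_iff t.countable_toSet).2 fun g _ => by rw [measure_smul]; exact hU0)
  have huniv : (Set.univ : Set X) = (fun g : G => g • x) '' Set.univ := by
    ext y
    simp only [mem_univ, image_univ, mem_range, true_iff]
    exact exists_smul_eq G x y
  have hσ : IsSigmaCompact (Set.univ : Set X) := by
    rw [huniv]
    exact isSigmaCompact_univ.image (hcont x)
  obtain ⟨K, hKc, hKU⟩ := hσ
  rw [← measure_univ_eq_zero, ← hKU]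
  exact measure_iUnion_null fun n => hcov (K n) (hKc n)

end OpenPos

/-! ## §2 Cells: indicator functions of compact open sets are test functions; translates; the refinement count -/

section CellFunctions

variable {G : Type*} [Group G] {X : Type*} [TopologicalSpace X] [MulAction G X]

/-- The indicator of a compact closed set has compact support. [cite: BernsteinZelevinsky1976, §1.1] -/
theorem hasCompactSupport_indicator_const_of_isCompact {S : Set X} (hSc : IsCompact S) (hScl : IsClosed S) (a : ℂ) :
    HasCompactSupport (S.indicator fun _ => a) :=
  HasCompactSupport.intro' hSc hScl fun _ hx => Set.indicator_of_notMem hx _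

omit [TopologicalSpace X] in
/-- Translating a cell translates its indicator: `1_{g • S}(x) = 1_S(g⁻¹ • x)`. [cite: BernsteinZelevinsky1976, §1.5] -/
theorem indicator_smul_set_const (g : G) (S : Set X) (a : ℂ) :
    (g • S).indicator (fun _ => a) = fun y => S.indicator (fun _ => a) (g⁻¹ • y) := by
  funext x
  by_cases hx : x ∈ g • S
  · rw [Set.indicator_of_mem hx, Set.indicator_of_mem (Set.mem_smul_set_iff_inv_smul_mem.1 hx)]
  · rw [Set.indicator_of_notMem hx, Set.indicator_of_notMem (fun h => hx (Set.mem_smul_set_iff_inv_smul_mem.2 h))]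

/-- **An invariant functional takes the same value on a translate of a compact open cell.** [cite: BernsteinZelevinsky1976, §1.18] -/
theorem apply_indicator_smul_set_eq {S : Set X} (hSo : IsOpen S) (hSc : IsCompact S) (hScl : IsClosed S)
    (T : (X → ℂ) →ₗ[ℂ] ℂ) (hT : ∀ F : X → ℂ, IsLocallyConstant F → HasCompactSupport F → ∀ g : G, T (fun x => F (g • x)) = T F)
    (g : G) (a : ℂ) : T ((g • S).indicator fun _ => a) = T (S.indicator fun _ => a) := by
  rw [indicator_smul_set_const]
  exact hT _ (Literature.GroupTheory.isLocallyConstant_indicator_const_of_isClopen ⟨hScl, hSo⟩ a)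
    (hasCompactSupport_indicator_const_of_isCompact hSc hScl a) g⁻¹

end CellFunctions

/-! ## §3 The refinement count and the chain identity `T(1_{M₁•x}) · μ(M₂•x) = T(1_{M₂•x}) · μ(M₁•x)` -/

section Count

variable {G : Type*} [Group G] [TopologicalSpace G] [IsTopologicalGroup G]
  {X : Type*} [TopologicalSpace X] [MulAction G X] [MeasurableSpace X] [OpensMeasurableSpace X]

/-- **REFINEMENT COUNT.**  `M` a compact open subgroup, `N ≤ M` open and normalised by `M`, orbit maps continuous and open, `μ` invariant, `T` an invariant
functional: for the number `k ≥ 1` of `N`-cells in `M • x`, `T(1_{M•x}) = k · T(1_{N•x})` and `μ(M•x) = k · μ(N•x)`. [cite: BernsteinZelevinsky1976, §1.18] -/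
theorem exists_apply_indicator_orbit_eq_natCast_mul (hcont : ∀ x : X, Continuous fun g : G => g • x)
    (hopen : ∀ x : X, IsOpenMap fun g : G => g • x) {M N : Subgroup G} (hMc : IsCompact (M : Set G))
    (hNo : IsOpen (N : Set G)) (hNM : N ≤ M) (hnorm : ∀ m ∈ M, ∀ n ∈ N, m * n * m⁻¹ ∈ N) (x : X)
    (μ : Measure X) [SMulInvariantMeasure G X μ]
    (T : (X → ℂ) →ₗ[ℂ] ℂ) (hT : ∀ F : X → ℂ, IsLocallyConstant F → HasCompactSupport F → ∀ g : G, T (fun y => F (g • y)) = T F) :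
    ∃ k : ℕ, 0 < k ∧ T ((orbit M x).indicator fun _ => (1 : ℂ)) = (k : ℂ) * T ((orbit N x).indicator fun _ => (1 : ℂ)) ∧
      μ (orbit M x) = (k : ENNReal) * μ (orbit N x) := by
  classical
  obtain ⟨A, hxA, htrans, hdisj, hU⟩ :=
    exists_finset_orbit_eq_biUnion_smul_orbit hcont hMc (isOpen_orbit_subgroup hopen N hNo) hNM hnorm x
  have hNc : IsCompact (N : Set G) := hMc.of_isClosed_subset (N.isClosed_of_isOpen hNo) (SetLike.coe_subset_coe.2 hNM)
  have hcell_o : IsOpen (orbit N x) := isOpen_orbit_subgroup hopen N hNo x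
  have hcell_c : IsCompact (orbit N x) := isCompact_orbit_subgroup hcont N hNc x
  have hcell_cl : IsClosed (orbit N x) := isClosed_orbit_subgroup hopen N hNo x
  refine ⟨A.card, Finset.card_pos.2 ⟨_, hxA⟩, ?_, ?_⟩
  · have hind : (orbit M x).indicator (fun _ => (1 : ℂ)) =
        ∑ ω ∈ A, (orbitRel.Quotient.orbit ω).indicator fun _ => (1 : ℂ) := by
      rw [hU, Finset.indicator_biUnion A _ hdisj, ← Finset.sum_fn]
    rw [hind, _root_.map_sum]
    have hterm : ∀ ω ∈ A, T ((orbitRel.Quotient.orbit ω).indicator fun _ => (1 : ℂ)) = T ((orbit N x).indicator fun _ => (1 : ℂ)) := by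
      intro ω hω
      obtain ⟨m, -, hm⟩ := htrans ω hω
      rw [hm]
      exact apply_indicator_smul_set_eq hcell_o hcell_c hcell_cl T hT m 1
    rw [Finset.sum_congr rfl hterm, Finset.sum_const, nsmul_eq_mul]
  · rw [hU, measure_biUnion_finset hdisj fun ω _ => ?_]
    · have hterm : ∀ ω ∈ A, μ (orbitRel.Quotient.orbit ω) = μ (orbit N x) := by
        intro ω hω
        obtain ⟨m, -, hm⟩ := htrans ω hω
        rw [hm, measure_smul]
      rw [Finset.sum_congr rfl hterm, Finset.sum_const, nsmul_eq_mul]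
    · rw [orbitRel.Quotient.orbit_eq_orbit_out ω Quotient.out_eq']
      exact (isOpen_orbit_subgroup hopen N hNo _).measurableSet

/-- **CHAIN IDENTITY.**  For any two compact open subgroups `M₁, M₂` of a totally disconnected group and any point `x`:
`T(1_{M₁•x}) · μ(M₂•x) = T(1_{M₂•x}) · μ(M₁•x)` — three refinements `M₁ ⊵ N₁ ⊵ N₂ ⊴ M₂` through open subgroups normalised by the larger group
(★ `exists_isOpen_subgroup_le_subset_conj_mem`). [cite: BernsteinZelevinsky1976, §1.18] -/
theorem apply_indicator_orbit_mul_measureReal_comm [TotallyDisconnectedSpace G] (hcont : ∀ x : X, Continuous fun g : G => g • x)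
    (hopen : ∀ x : X, IsOpenMap fun g : G => g • x) {M₁ M₂ : Subgroup G} (h₁o : IsOpen (M₁ : Set G)) (h₁c : IsCompact (M₁ : Set G))
    (h₂o : IsOpen (M₂ : Set G)) (h₂c : IsCompact (M₂ : Set G)) (x : X) (μ : Measure X) [SMulInvariantMeasure G X μ]
    (T : (X → ℂ) →ₗ[ℂ] ℂ) (hT : ∀ F : X → ℂ, IsLocallyConstant F → HasCompactSupport F → ∀ g : G, T (fun y => F (g • y)) = T F) :
    T ((orbit M₁ x).indicator fun _ => (1 : ℂ)) * (μ.real (orbit M₂ x) : ℂ) =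
      T ((orbit M₂ x).indicator fun _ => (1 : ℂ)) * (μ.real (orbit M₁ x) : ℂ) := by
  -- the refinements
  obtain ⟨N₁, hN₁o, hN₁M₁, hN₁M₂, hN₁n⟩ :=
    Literature.Topology.Algebra.exists_isOpen_subgroup_le_subset_conj_mem M₁ h₁o h₁c (h₂o.mem_nhds M₂.one_mem)
  obtain ⟨N₂, hN₂o, hN₂M₂, hN₂N₁, hN₂n⟩ :=
    Literature.Topology.Algebra.exists_isOpen_subgroup_le_subset_conj_mem M₂ h₂o h₂c (hN₁o.mem_nhds N₁.one_mem)
  have hN₁c : IsCompact (N₁ : Set G) := h₁c.of_isClosed_subset (N₁.isClosed_of_isOpen hN₁o) (SetLike.coe_subset_coe.2 hN₁M₁)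
  have hN₂N₁' : N₂ ≤ N₁ := SetLike.coe_subset_coe.1 hN₂N₁
  have hN₂n' : ∀ m ∈ N₁, ∀ n ∈ N₂, m * n * m⁻¹ ∈ N₂ := fun m hm n hn => hN₂n m (hN₁M₂ hm) n hn
  obtain ⟨a, -, hTa, hμa⟩ := exists_apply_indicator_orbit_eq_natCast_mul hcont hopen h₁c hN₁o hN₁M₁ hN₁n x μ T hT
  obtain ⟨b, -, hTb, hμb⟩ := exists_apply_indicator_orbit_eq_natCast_mul hcont hopen hN₁c hN₂o hN₂N₁' hN₂n' x μ T hT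
  obtain ⟨c, -, hTc, hμc⟩ := exists_apply_indicator_orbit_eq_natCast_mul hcont hopen h₂c hN₂o hN₂M₂ hN₂n x μ T hT
  have hra : μ.real (orbit M₁ x) = a * μ.real (orbit N₁ x) := by
    rw [measureReal_def, hμa, ENNReal.toReal_mul, ENNReal.toReal_natCast, measureReal_def]
  have hrb : μ.real (orbit N₁ x) = b * μ.real (orbit N₂ x) := by
    rw [measureReal_def, hμb, ENNReal.toReal_mul, ENNReal.toReal_natCast, measureReal_def]
  have hrc : μ.real (orbit M₂ x) = c * μ.real (orbit N₂ x) := by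
    rw [measureReal_def, hμc, ENNReal.toReal_mul, ENNReal.toReal_natCast, measureReal_def]
  rw [hTa, hTb, hTc, hra, hrb, hrc]
  push_cast
  ring

end Count

/-! ## §4 Transport of cells to the base point: `M • (g • x) = g • (M^g • x)` with `M^g = g⁻¹ M g = M.comap (conj g)` (compact open by ★ `isOpen_coe_comap_conj` ∕ ★ `isCompact_coe_comap_conj`) -/

section Transport

variable {G : Type*} [Group G] {X : Type*} [MulAction G X]

/-- **TRANSPORT OF CELLS**: `M • (g • x) = g • (M^g • x)`. [cite: BernsteinZelevinsky1976, §1.5] -/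
theorem orbit_smul_eq_smul_orbit_comap_conj (M : Subgroup G) (g : G) (x : X) :
    orbit M (g • x) = g • orbit (M.comap (MulAut.conj g).toMonoidHom) x := by
  ext y
  constructor
  · rintro ⟨m, rfl⟩
    refine ⟨(g⁻¹ * m * g) • x, ⟨⟨g⁻¹ * m * g, ?_⟩, rfl⟩, ?_⟩
    · rw [mem_comap_conj_iff]
      have : g * (g⁻¹ * ↑m * g) * g⁻¹ = m := by group
      rw [this]; exact m.2
    · show g • (g⁻¹ * ↑m * g) • x = (m : G) • g • x
      rw [smul_smul, smul_smul]
      congr 1; group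
  · rintro ⟨_, ⟨h, rfl⟩, rfl⟩
    refine ⟨⟨g * h * g⁻¹, (mem_comap_conj_iff M g h).1 h.2⟩, ?_⟩
    show (g * ↑h * g⁻¹) • g • x = g • (h : G) • x
    rw [smul_smul, smul_smul]
    congr 1; group

end Transport

/-! ## §5 The uniqueness theorem -/

section Main

variable {G : Type*} [Group G] [TopologicalSpace G] [IsTopologicalGroup G] [TotallyDisconnectedSpace G]
  {X : Type*} [TopologicalSpace X] [MulAction G X] [ContinuousSMul G X] [MeasurableSpace X] [OpensMeasurableSpace X]

/-- **EVERY CELL IS WORTH `c · μ`.**  With `c := T(1_{K₀•x₀}) ∕ μ(K₀•x₀)`: for every compact open subgroup `N` and every point `y` of the (single) orbit,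
`T(1_{N•y}) = c · μ(N•y)`. [cite: BernsteinZelevinsky1976, §1.18] -/
theorem apply_indicator_orbit_eq_const_mul_measureReal (K₀ : Subgroup G) (hK₀o : IsOpen (K₀ : Set G)) (hK₀c : IsCompact (K₀ : Set G))
    (hopen : ∀ x : X, IsOpenMap fun g : G => g • x) [IsPretransitive G X]
    (μ : Measure X) [SMulInvariantMeasure G X μ] [IsFiniteMeasureOnCompacts μ] [μ.IsOpenPosMeasure]
    (T : (X → ℂ) →ₗ[ℂ] ℂ) (hT : ∀ F : X → ℂ, IsLocallyConstant F → HasCompactSupport F → ∀ g : G, T (fun y => F (g • y)) = T F)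
    (x₀ : X) {N : Subgroup G} (hNo : IsOpen (N : Set G)) (hNc : IsCompact (N : Set G)) (y : X) :
    T ((orbit N y).indicator fun _ => (1 : ℂ)) =
      T ((orbit K₀ x₀).indicator fun _ => (1 : ℂ)) / (μ.real (orbit K₀ x₀) : ℂ) * (μ.real (orbit N y) : ℂ) := by
  have hcont : ∀ x : X, Continuous fun g : G => g • x := fun x => continuous_id.smul continuous_const
  obtain ⟨g, rfl⟩ := exists_smul_eq G x₀ y
  -- the conjugate `K' = g⁻¹ K₀ g`
  have hK'o := isOpen_coe_comap_conj K₀ hK₀o g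
  have hK'c := isCompact_coe_comap_conj K₀ hK₀c g
  set K' : Subgroup G := K₀.comap (MulAut.conj g).toMonoidHom with hK'
  -- (1) chain at `g • x₀` between `N` and `K₀`; (3) chain at `x₀` between `K'` and `K₀`
  have h1 := apply_indicator_orbit_mul_measureReal_comm hcont hopen hNo hNc hK₀o hK₀c (g • x₀) μ T hT
  have h3 := apply_indicator_orbit_mul_measureReal_comm hcont hopen hK'o hK'c hK₀o hK₀c x₀ μ T hT
  -- (2) transport `K₀ • (g • x₀) = g • (K' • x₀)`
  have h2T : T ((orbit K₀ (g • x₀)).indicator fun _ => (1 : ℂ)) = T ((orbit K' x₀).indicator fun _ => (1 : ℂ)) := by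
    rw [orbit_smul_eq_smul_orbit_comap_conj]
    exact apply_indicator_smul_set_eq (isOpen_orbit_subgroup hopen K' hK'o x₀) (isCompact_orbit_subgroup hcont K' hK'c x₀)
      (isClosed_orbit_subgroup hopen K' hK'o x₀) T hT g 1
  have h2μ : μ.real (orbit K₀ (g • x₀)) = μ.real (orbit K' x₀) := by
    rw [orbit_smul_eq_smul_orbit_comap_conj, measureReal_def, measure_smul, measureReal_def]
  -- non-vanishing of the reference masses
  have hpos : ∀ {M : Subgroup G}, IsOpen (M : Set G) → IsCompact (M : Set G) → ∀ x : X, (μ.real (orbit M x) : ℂ) ≠ 0 := by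
    intro M hMo hMc x
    rw [Ne, Complex.ofReal_eq_zero, measureReal_def, ENNReal.toReal_eq_zero_iff, not_or]
    exact ⟨((isOpen_orbit_subgroup hopen M hMo x).measure_pos μ ⟨x, mem_orbit_self x⟩).ne',
      (isCompact_orbit_subgroup hcont M hMc x).measure_lt_top.ne⟩
  have hq := hpos hK₀o hK₀c (g • x₀)
  have hr := hpos hK₀o hK₀c x₀
  rw [h2T, h2μ] at h1
  rw [← h2μ] at h1 h3
  -- `A q = B p`, `B r = C q` ⇒ `A = C / r * p`
  set A := T ((orbit N (g • x₀)).indicator fun _ => (1 : ℂ))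
  set B := T ((orbit K' x₀).indicator fun _ => (1 : ℂ))
  set C := T ((orbit K₀ x₀).indicator fun _ => (1 : ℂ))
  set p := (μ.real (orbit N (g • x₀)) : ℂ)
  set q := (μ.real (orbit K₀ (g • x₀)) : ℂ)
  set r := (μ.real (orbit K₀ x₀) : ℂ)
  have key : A * q * r = C * p * q := by
    calc A * q * r = B * p * r := by rw [h1]
      _ = B * r * p := by ring
      _ = C * q * p := by rw [h3]
      _ = C * p * q := by ring
  have key' : A * r = C * p := mul_right_cancel₀ hq (by calc A * r * q = A * q * r := by ring
    _ = C * p * q := key)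
  field_simp
  linear_combination key'

/-- **UNIQUENESS OF INVARIANT FUNCTIONALS ON `S(X)` OF ONE ORBIT («COINV-1», dimension ≤ 1).**  `G` a totally disconnected topological group with a compact
open subgroup `K₀`, acting continuously and transitively on `X` with open orbit maps; `μ` a `G`-invariant measure on `X`, finite on compact sets, positive on
non-empty open sets; `T` a `ℂ`-linear functional on `X → ℂ` which is `G`-invariant on the locally constant compactly supported functions.  Then
`∃ c, ∀ F` locally constant with compact support, `T F = c · ∫ F dμ`. [cite: BernsteinZelevinsky1976, §1.18] [cite: Rogawski1990, §8.1 p. 113] -/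
theorem exists_forall_apply_eq_const_mul_integral_of_smul_invariant (K₀ : Subgroup G) (hK₀o : IsOpen (K₀ : Set G))
    (hK₀c : IsCompact (K₀ : Set G)) (hopen : ∀ x : X, IsOpenMap fun g : G => g • x) [IsPretransitive G X]
    (μ : Measure X) [SMulInvariantMeasure G X μ] [IsFiniteMeasureOnCompacts μ] [μ.IsOpenPosMeasure]
    (T : (X → ℂ) →ₗ[ℂ] ℂ) (hT : ∀ F : X → ℂ, IsLocallyConstant F → HasCompactSupport F → ∀ g : G, T (fun y => F (g • y)) = T F) :
    ∃ c : ℂ, ∀ F : X → ℂ, IsLocallyConstant F → HasCompactSupport F → T F = c * ∫ x, F x ∂μ := by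
  classical
  rcases isEmpty_or_nonempty X with hX | ⟨⟨x₀⟩⟩
  · refine ⟨0, fun F _ _ => ?_⟩
    have hF0 : F = 0 := funext fun x => isEmptyElim x
    rw [hF0, map_zero, zero_mul]
  have hcont : ∀ x : X, Continuous fun g : G => g • x := fun x => continuous_id.smul continuous_const
  set c : ℂ := T ((orbit K₀ x₀).indicator fun _ => (1 : ℂ)) / (μ.real (orbit K₀ x₀) : ℂ) with hc
  refine ⟨c, fun F hF hFs => ?_⟩
  -- a level: an open subgroup `N ≤ K₀` fixing `F`
  obtain ⟨N, hNo, hNK₀, hFN⟩ : ∃ N : Subgroup G, IsOpen (N : Set G) ∧ N ≤ K₀ ∧ ∀ x : X, ∀ n ∈ (N : Set G), F (n • x) = F x := by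
    have hbasis : ∀ V ∈ 𝓝 (1 : G), ∃ N : {N : Subgroup G // IsOpen (N : Set G) ∧ N ≤ K₀}, ((N.1 : Subgroup G) : Set G) ⊆ V := by
      intro V hV
      obtain ⟨N, hNo, hNK₀, hNV, -⟩ := Literature.Topology.Algebra.exists_isOpen_subgroup_le_subset_conj_mem K₀ hK₀o hK₀c hV
      exact ⟨⟨N, hNo, hNK₀⟩, hNV⟩
    obtain ⟨⟨N, hNo, hNK₀⟩, hN⟩ := exists_forall_smul_eq_of_hasCompactSupport_of_basis
      (K := fun N : {N : Subgroup G // IsOpen (N : Set G) ∧ N ≤ K₀} => ((N.1 : Subgroup G) : Set G)) hbasis hF hFs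
    exact ⟨N, hNo, hNK₀, hN⟩
  have hNc : IsCompact (N : Set G) := hK₀c.of_isClosed_subset (N.isClosed_of_isOpen hNo) (SetLike.coe_subset_coe.2 hNK₀)
  have hNorb : ∀ x : X, IsOpen (orbit N x) := isOpen_orbit_subgroup hopen N hNo
  -- the cell decomposition of `F`
  obtain ⟨A, -, hFA⟩ := exists_eq_finset_sum_indicator_orbit_of_forall_smul_eq N hNorb hFs (fun n hn x => hFN x n hn)
  have hFA' : F = ∑ ω ∈ A, (orbitRel.Quotient.orbit ω).indicator fun _ => F ω.out := by
    rw [Finset.sum_fn]; exact hFA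
  -- each cell is worth `c · μ`
  have hcellT : ∀ ω : orbitRel.Quotient N X,
      T ((orbitRel.Quotient.orbit ω).indicator fun _ => F ω.out) = c * ((F ω.out) * (μ.real (orbitRel.Quotient.orbit ω) : ℂ)) := by
    intro ω
    rw [orbitRel.Quotient.orbit_eq_orbit_out ω Quotient.out_eq']
    have hind : (orbit N ω.out).indicator (fun _ => F ω.out) = F ω.out • (orbit N ω.out).indicator fun _ => (1 : ℂ) := by
      funext x
      by_cases hx : x ∈ orbit N ω.out
      · simp only [Set.indicator_of_mem hx, Pi.smul_apply, smul_eq_mul, mul_one]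
      · simp only [Set.indicator_of_notMem hx, Pi.smul_apply, smul_eq_mul, mul_zero]
    rw [hind, map_smul, apply_indicator_orbit_eq_const_mul_measureReal K₀ hK₀o hK₀c hopen μ T hT x₀ hNo hNc ω.out, smul_eq_mul, ← hc]
    ring
  have hcellI : ∀ ω : orbitRel.Quotient N X,
      ∫ x, (orbitRel.Quotient.orbit ω).indicator (fun _ => F ω.out) x ∂μ = (F ω.out) * (μ.real (orbitRel.Quotient.orbit ω) : ℂ) := by
    intro ω
    rw [integral_indicator_const (F ω.out) ?_, Complex.real_smul, mul_comm]
    rw [orbitRel.Quotient.orbit_eq_orbit_out ω Quotient.out_eq']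
    exact (hNorb _).measurableSet
  have hcellInt : ∀ ω ∈ A, Integrable ((orbitRel.Quotient.orbit ω).indicator fun _ => F ω.out) μ := by
    intro ω _
    rw [orbitRel.Quotient.orbit_eq_orbit_out ω Quotient.out_eq']
    refine (integrableOn_const ?_).integrable_indicator (hNorb _).measurableSet
    exact (isCompact_orbit_subgroup hcont N hNc _).measure_lt_top.ne
  rw [hFA', _root_.map_sum]
  simp_rw [Finset.sum_apply]
  rw [integral_finsetSum A hcellInt, Finset.mul_sum]
  exact Finset.sum_congr rfl fun ω _ => by rw [hcellT, hcellI]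

/-- **UNIQUENESS, PLAIN-FUNCTIONAL FORM.**  The same conclusion for a bare function `T : (X → ℂ) → ℂ` which is only assumed ADDITIVE, HOMOGENEOUS and
`G`-INVARIANT on the locally constant compactly supported functions (the form in which the Howe induction produces its functionals, e.g. `T − c·Φ(u, ·)`
with an orbital integral `Φ(u, ·)` that is linear on test functions only): `T` restricted to the submodule `S(X)` is linear, extends to a linear form on
`X → ℂ` (Mathlib `LinearMap.exists_extend`), and the linear head applies. [cite: BernsteinZelevinsky1976, §1.18] -/
theorem exists_forall_apply_eq_const_mul_integral_of_smul_invariant_of_additive (K₀ : Subgroup G) (hK₀o : IsOpen (K₀ : Set G))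
    (hK₀c : IsCompact (K₀ : Set G)) (hopen : ∀ x : X, IsOpenMap fun g : G => g • x) [IsPretransitive G X]
    (μ : Measure X) [SMulInvariantMeasure G X μ] [IsFiniteMeasureOnCompacts μ] [μ.IsOpenPosMeasure]
    (T : (X → ℂ) → ℂ)
    (hadd : ∀ F F' : X → ℂ, IsLocallyConstant F → HasCompactSupport F → IsLocallyConstant F' → HasCompactSupport F' →
      T (F + F') = T F + T F')
    (hsmul : ∀ (a : ℂ) (F : X → ℂ), IsLocallyConstant F → HasCompactSupport F → T (a • F) = a * T F)
    (hT : ∀ F : X → ℂ, IsLocallyConstant F → HasCompactSupport F → ∀ g : G, T (fun y => F (g • y)) = T F) :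
    ∃ c : ℂ, ∀ F : X → ℂ, IsLocallyConstant F → HasCompactSupport F → T F = c * ∫ x, F x ∂μ := by
  -- the submodule `S(X)` of test functions
  let V : Submodule ℂ (X → ℂ) :=
    { carrier := {F | IsLocallyConstant F ∧ HasCompactSupport F}
      add_mem' := fun {F F'} hF hF' => ⟨hF.1.add hF'.1, hF.2.add hF'.2⟩
      zero_mem' := ⟨IsLocallyConstant.const (0 : ℂ), HasCompactSupport.zero⟩
      smul_mem' := fun a F hF => ⟨hF.1.comp fun z => a • z, hF.2.smul_left⟩ }
  have hVmem : ∀ {F : X → ℂ}, F ∈ V ↔ IsLocallyConstant F ∧ HasCompactSupport F := fun {F} => Iff.rfl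
  -- `T` is linear on `S(X)`
  let T₀ : V →ₗ[ℂ] ℂ :=
    { toFun := fun F => T (F : X → ℂ)
      map_add' := fun F F' => hadd _ _ F.2.1 F.2.2 F'.2.1 F'.2.2
      map_smul' := fun a F => hsmul a _ F.2.1 F.2.2 }
  obtain ⟨T₁, hT₁⟩ := LinearMap.exists_extend T₀
  have hT₁V : ∀ F : X → ℂ, IsLocallyConstant F → HasCompactSupport F → T₁ F = T F := fun F hF hFs => by
    have := LinearMap.congr_fun hT₁ ⟨F, hVmem.2 ⟨hF, hFs⟩⟩
    simpa [T₀] using this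
  -- `T₁` is invariant on `S(X)` (translates of test functions are test functions)
  have hT₁inv : ∀ F : X → ℂ, IsLocallyConstant F → HasCompactSupport F → ∀ g : G, T₁ (fun y => F (g • y)) = T₁ F := by
    intro F hF hFs g
    have hF' : IsLocallyConstant fun y => F (g • y) := hF.comp_continuous (continuous_const_smul g)
    have hFs' : HasCompactSupport fun y => F (g • y) := hFs.comp_homeomorph (Homeomorph.smul g)
    rw [hT₁V _ hF' hFs', hT₁V F hF hFs, hT F hF hFs g]
  obtain ⟨c, hc⟩ := exists_forall_apply_eq_const_mul_integral_of_smul_invariant K₀ hK₀o hK₀c hopen μ T₁ hT₁inv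
  exact ⟨c, fun F hF hFs => by rw [← hT₁V F hF hFs, hc F hF hFs]⟩

end Main

end Literature.MeasureTheory.Group
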